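import Literature.AnabelianGeometry.EtaleTheta.Discharge.Sec5Thm510i
import Literature.AnabelianGeometry.EtaleTheta.Discharge.Sec5Thm510ii
import Literature.AnabelianGeometry.EtaleTheta.Discharge.Sec5Thm510iii

/-!
# [EtTh] §5, Theorem 5.10 (i)–(iii) assembled (pp. 333–335 / PDF pp. 107–109)

Mochizuki, *The étale theta function …*, Publ. RIMS **45** (2009)
[cite: MochizukiEtTh2009, Thm 5.10 p.333 (PDF p.107)].  Seat abc-iut-L2-d4 (node `EtTh:Thm5.10`); PROOF-ONLY assembly of
`Discharge/Sec5Thm510i.lean`, `Sec5Thm510ii.lean`, `Sec5Thm510iii.lean`: abc-iut-L2-t4's three typed statements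
`PreservesIsoClasses`, `PsiAutPreserves`, `MonoThetaEnvCompat` from ONE list of printed inputs — so that (iii) is
no longer stated "modulo (ii)" but modulo the same primitive inputs as (ii): a faithful 1-compatible `Ψ^bs`
(Thm. 4.4 (i)), the birational square and `Ψ^birat_Aut(K^×) = K^×` (Prop. 3.4 (ii)), the transport of the `N`-th
root `(A_N, B_N, s^⊓_N, s^⊔_N)` and of `s^trv_N` (Prop. 4.2 (iv), Thm. 4.4 (ii)(iv), Thm. 5.7), the base
automorphism `θ` preserving `Im(Π^tp_Y̲)`, `H_{B_N}` with a representative `ψY` of the automorphisms of `Π^tp_X̲`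
over it (Prop. 2.4), the §5 named inputs of abc-iut-L2-t4 (`SgpCapSpec`, `SgpCupSpec`, `Epi`, `SgpCapSection`,
`SgpCupSection`, `SectionsFactor`, `OuterActionLZ`, `ConstantsEqNormalizer`), and for (i) the Frobenius-triviality
/ pre-step / zero-divisor inputs.  HONEST FRAMING: a kernel-checked implication between typed statements;
typed ≠ discharged; no side taken on anything downstream. -/

namespace Literature.AnabelianGeometry.EtaleTheta

open CategoryTheory
open scoped Pointwise
open Literature.AlgebraicGeometry.Frobenioids

universe w v v' u u'

namespace ThetaFrobenioid

variable {C : Type u} [Category.{v} C] {D : Type u'} [Category.{v'} D] {𝔉 : ThetaFrobenioid.{w} C D}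

/-- **Theorem 5.10 (iii) for the mono-theta environment without extra Kummer part** (`DK = ∅`, abc-iut-L2-t4's
`frdMonoThetaEnv … ∅`): then no `DK`-hypothesis remains — the (unfolded) conclusion of Theorem 5.10 (iii) follows from
Theorem 5.10 (ii) and the base compatibility of `ψY` alone.  [cite: MochizukiEtTh2009, Thm 5.10 (iii) p.334 (PDF p.108)] -/
theorem exists_monoThetaIso_of_psiAutPreserves_empty (h1 : 𝔉.SectionsFactor)
    (h3 : 𝔉.OuterActionLZ) (hsec : 𝔉.SgpCapSection) (hcs : 𝔉.SgpCupSection)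
    (h8 : 𝔉.ConstantsEqNormalizer) (Ψ : C ≌ C) (β : Ψ.functor.obj 𝔉.BN ≅ 𝔉.BN)
    (ΨbiratAut : 𝔉.biratUnits 𝔉.BN ≃* 𝔉.biratUnits 𝔉.BN) (hii : 𝔉.PsiAutPreserves Ψ β ΨbiratAut)
    (ψY : 𝔉.PiX ≃ₜ* 𝔉.PiX)
    (hbase : ∀ g, 𝔉.autBase 𝔉.BN (𝔉.psiAut Ψ β (𝔉.sgpCap (𝔉.ρ g))) = 𝔉.ρ (ψY g))
    (hY : 𝔉.PiY.map ψY.toMulEquiv.toMonoidHom = 𝔉.PiY)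
    (hYdd : 𝔉.PiYdd.map ψY.toMulEquiv.toMonoidHom = 𝔉.PiYdd) :
    ∃ (x₃ : 𝔉.PiX) (γ : (𝔉.frdMonoThetaEnv h1 h3 hsec hcs h8 ∅).Iso (𝔉.frdMonoThetaEnv h1 h3 hsec hcs h8 ∅))
      (k : Aut 𝔉.BN), (∀ x, 𝔉.psiAut Ψ β (𝔉.epsilon x) = k * 𝔉.epsilon (γ.e x) * k⁻¹) ∧
        ∀ x, 𝔉.toPiY (γ.e x) = (ψY.trans (𝔉.conjTop x₃⁻¹)) (𝔉.toPiY x) :=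
  exists_monoThetaIso_of_psiAutPreserves h1 h3 hsec hcs h8 ∅ Ψ β ΨbiratAut hii ψY hbase hY hYdd
    (fun _ _ hd => absurd hd (Set.notMem_empty _))

/-- **[EtTh] Theorem 5.10 (iii) as typed** (abc-iut-L2-t4's `MonoThetaEnvCompat`, v2 shape of p410580: the membership of
`ψY` in the class induced by `Ψ^bs` is the three hypothesis arguments; general Kummer part `DK`): rewrap of
`exists_monoThetaIso_of_psiAutPreserves` — from Theorem 5.10 (ii) as typed, a representative `ψY` of the class of
automorphisms of `Π^tp_X̲` induced by `Ψ^bs` (lying over `Ψ^Aut` through `ρ`, preserving `Π^tp_Y̲`, `Π^tp_Ÿ̲`) and the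
stability of `DK` under compatible pairs.  [cite: MochizukiEtTh2009, Thm 5.10 (iii) p.334–335 (PDF pp.108–109)] -/
theorem monoThetaEnvCompat_of_psiAutPreserves (h1 : 𝔉.SectionsFactor)
    (h3 : 𝔉.OuterActionLZ) (hsec : 𝔉.SgpCapSection) (hcs : 𝔉.SgpCupSection)
    (h8 : 𝔉.ConstantsEqNormalizer) (DK : Set (TopOut 𝔉.EPiN)) (Ψ : C ≌ C)
    (β : Ψ.functor.obj 𝔉.BN ≅ 𝔉.BN) (ΨbiratAut : 𝔉.biratUnits 𝔉.BN ≃* 𝔉.biratUnits 𝔉.BN)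
    (hii : 𝔉.PsiAutPreserves Ψ β ΨbiratAut) (ψY : 𝔉.PiX ≃ₜ* 𝔉.PiX)
    (hbase : ∀ g, 𝔉.autBase 𝔉.BN (𝔉.psiAut Ψ β (𝔉.sgpCap (𝔉.ρ g))) = 𝔉.ρ (ψY g))
    (hY : 𝔉.PiY.map ψY.toMulEquiv.toMonoidHom = 𝔉.PiY)
    (hYdd : 𝔉.PiYdd.map ψY.toMulEquiv.toMonoidHom = 𝔉.PiYdd)
    (hDK : ∀ {Φ : Aut 𝔉.BN ≃* Aut 𝔉.BN} {ψ : 𝔉.PiX ≃ₜ* 𝔉.PiX} (hc : 𝔉.IsEnvCompatible Φ ψ),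
      ∀ d ∈ DK, TopOut.transport (𝔉.envAut (hc.stabilizesEPiN hsec)) d ∈
        (𝔉.frdMonoThetaEnv h1 h3 hsec hcs h8 DK).D) :
    𝔉.MonoThetaEnvCompat h1 h3 hsec hcs h8 DK Ψ β ψY hbase hY hYdd := by
  obtain ⟨x₃, γ, k, hk, hγ⟩ := exists_monoThetaIso_of_psiAutPreserves h1 h3 hsec hcs h8 DK Ψ β ΨbiratAut hii ψY
    hbase hY hYdd hDK
  exact ⟨x₃, γ, k, hk, fun x => by rw [hγ x, ContinuousMulEquiv.trans_apply, conjTop_apply, inv_inv]⟩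

/-- **[EtTh] Theorem 5.10 (ii) and (iii) from the primitive inputs** (see the module docstring): the pair
`(PsiAutPreserves Ψ β Ψ^birat_Aut, MonoThetaEnvCompat … ∅ Ψ β ψY hbase hY hYdd)` for the mono-theta
environment with no extra Kummer part (`DK = ∅`).  The representative `ψY` is required to lie over `Ψ^Aut`
through `ρ` (`hbase`) — in print "the `Π^tp_X`-conjugacy class of automorphisms of `Π^tp_Y` induced by `Ψ^bs`".
[cite: MochizukiEtTh2009, Thm 5.10 (ii)(iii) p.333–335 (PDF pp.107–109)] -/
theorem thm510_ii_iii_of_inputs (Ψ : C ≌ C) (β : Ψ.functor.obj 𝔉.BN ≅ 𝔉.BN)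
    [Epi 𝔉.sCap] [Epi 𝔉.sCup] (hcap : 𝔉.SgpCapSpec) (hcup : 𝔉.SgpCupSpec)
    (hsec : 𝔉.SgpCapSection) (hcs : 𝔉.SgpCupSection) (h1 : 𝔉.SectionsFactor) (h3 : 𝔉.OuterActionLZ)
    (h8 : 𝔉.ConstantsEqNormalizer)
    (ΨbiratAut : 𝔉.biratUnits 𝔉.BN ≃* 𝔉.biratUnits 𝔉.BN)
    (Ψbs : D ⥤ D) [Ψbs.Faithful] (eΨ : Ψ.functor ⋙ 𝔉.base ≅ 𝔉.base ⋙ Ψbs)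
    (hsq : ∀ u : 𝔉.units 𝔉.BN, ∀ hu : 𝔉.psiAut Ψ β u ∈ 𝔉.units 𝔉.BN,
      ΨbiratAut (𝔉.unitsToBirat 𝔉.BN u) = 𝔉.unitsToBirat 𝔉.BN ⟨_, hu⟩)
    (hconst : 𝔉.constEmb.range.map ΨbiratAut.toMonoidHom = 𝔉.constEmb.range)
    (α : Ψ.functor.obj 𝔉.AN ≅ 𝔉.AN) (e : 𝔉.AN ≅ 𝔉.AN) (Dc Dp : Aut 𝔉.BN)
    (θ : Aut (𝔉.base.obj 𝔉.BN) ≃* Aut (𝔉.base.obj 𝔉.BN))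
    (hT : α.inv ≫ Ψ.functor.map 𝔉.sCap ≫ β.hom = e.hom ≫ 𝔉.sCap ≫ Dc.hom)
    (hT' : α.inv ≫ Ψ.functor.map 𝔉.sCup ≫ β.hom = e.hom ≫ 𝔉.sCup ≫ Dp.hom)
    (hind : ∃ δ₂' ∈ 𝔉.muTorsion 𝔉.BN (2 * 𝔉.l * 𝔉.N) ⊓ 𝔉.OKxRootN, ∃ δ₃' ∈ 𝔉.sgpCap.range,
      Dc⁻¹ * Dp = δ₂' * δ₃')
    (hstrv : ∀ g : Aut (𝔉.base.obj 𝔉.BN),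
      α.inv ≫ Ψ.functor.map (𝔉.strv (𝔉.autBaseIsoAB.symm g)).hom ≫ α.hom ≫ e.hom =
        e.hom ≫ (𝔉.strv (𝔉.autBaseIsoAB.symm (θ g))).hom)
    (hY : 𝔉.imPiY.map θ.toMonoidHom = 𝔉.imPiY) (hYdd : 𝔉.HB.map θ.toMonoidHom = 𝔉.HB)
    (ψY : 𝔉.PiX ≃ₜ* 𝔉.PiX)
    (hbase : ∀ g, 𝔉.autBase 𝔉.BN (𝔉.psiAut Ψ β (𝔉.sgpCap (𝔉.ρ g))) = 𝔉.ρ (ψY g))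
    (hψY : 𝔉.PiY.map ψY.toMulEquiv.toMonoidHom = 𝔉.PiY)
    (hψYdd : 𝔉.PiYdd.map ψY.toMulEquiv.toMonoidHom = 𝔉.PiYdd) :
    𝔉.PsiAutPreserves Ψ β ΨbiratAut ∧ 𝔉.MonoThetaEnvCompat h1 h3 hsec hcs h8 ∅ Ψ β ψY hbase hψY hψYdd := by
  have hii : 𝔉.PsiAutPreserves Ψ β ΨbiratAut :=
    psiAutPreserves_of Ψ β hcap hcup hsec h3 h8 ΨbiratAut Ψbs eΨ hsq hconst α e Dc Dp θ hT hT' hind hstrv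
      hY hYdd
  exact ⟨hii, monoThetaEnvCompat_of_psiAutPreserves h1 h3 hsec hcs h8 ∅ Ψ β ΨbiratAut hii ψY hbase hψY hψYdd
    (fun _ _ hd => absurd hd (Set.notMem_empty _))⟩

end ThetaFrobenioid

end Literature.AnabelianGeometry.EtaleTheta
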